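import Literature.AlgebraicGeometry.HodgeTheory.ComplexOrientationDegreeOne
import Literature.AlgebraicGeometry.HodgeTheory.TopDegreeClasses
import Literature.AlgebraicGeometry.HodgeTheory.GysinKernelProofs
import Literature.AlgebraicTopology.SingularHomology.CompactGroupExteriorCohomology
import HarnessLib

/-!
# Pull-back along an isomorphism is push-forward along its inverse (complex orientations); automorphisms act trivially on top cohomology

Family `hodge`, layer `Literature/AlgebraicGeometry/HodgeTheory`. PROOF FILE (theorems only, no
named fact, no definition) on the tree's real Gysin morphisms `complexGysin μ`
(`HodgeTheory/ComplexGysin`, W. Fulton, *Young Tableaux* App. B §B.1 (2)–(6)) for the COMPLEX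
orientation family `complexOrientationFamily` (`HodgeTheory/ComplexOrientationFamily`), where a
birational morphism — in particular an isomorphism — of smooth projective `n`-folds has degree `+1`
(`complexGysin_complexOrientationFamily_one_of_isBirational`, Fulton, *Intersection Theory*
Lemma 19.1.2 with `deg = 1`; Milnor–Stasheff §13: holomorphic maps preserve the complex orientation):

* `complexGysin_congr_mapContinuous` — `f_*` depends on `f` only through the continuous map `f(ℂ)`;
* `complexBetti_map_eq_complexGysin_of_comp_eq_id` — **`g^* = f_*` when `f ≫ g = 𝟙` and `f` is
  birational** (`f_*(f^* g^* x ∪ 1) = g^* x ∪ f_* 1 = g^* x`, projection formula and `f_* 1 = 1`);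
* `complexBetti_map_complexGysin_of_comp_eq_id` — **equivariance of Gysin images under
  automorphisms**: `f^*(φ_* y) = (φ ≫ g)_* y` for `g ≫ f = 𝟙`, `g` birational (Fulton App. B (5):
  "`f^* ι_* = ι'_* f'^*` for a fibre square", here the square of an isomorphism);
* `complexGysin_comp_one_of_isBirational` — `(t ≫ φ)_* 1 = φ_* 1` for `t` birational between smooth
  projective `d`-folds (reparametrising a subvariety does not change its class);
* `complexBetti_map_top_eq_self_of_isBirational` — **a birational self-map of a smooth projective
  `n`-fold acts as the identity on `H²ⁿ(X(ℂ); ℂ)`** (`⟨t^* y, [X]⟩ = ⟨y, t_*[X]⟩ = ⟨y, [X]⟩`, and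
  `H₂ₙ(X(ℂ); ℂ) = ℂ · [X]` by Poincaré duality from `H⁰ = ℂ · 1`, universal coefficients over `ℂ`).

These are the bookkeeping identities behind "`g^* cl(Z) = cl(g⁻¹ Z)`" for the action of a finite
group of automorphisms on cycle classes (Shioda, Math. Ann. 245 (1979) §1; Ran, Compositio Math. 42
(1980) §1), used for the lines of the Fermat surface.

## References

* [FultonYoungTableaux1997] W. Fulton, Young Tableaux, CUP 1997, Appendix B §B.1 (2)–(6).
* [Fulton1998] W. Fulton, Intersection Theory, 2nd ed. 1998, §1.4 and Lemma 19.1.2.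
* [MilnorStasheff1974] J. Milnor, J. Stasheff, Characteristic Classes, PUP 1974, §13 p. 151.
* [HatcherAT2002] A. Hatcher, Algebraic Topology, CUP 2002, §3.1 Thm. 3.2, §3.3 Thm. 3.30.
-/

noncomputable section

open CategoryTheory AlgebraicGeometry
open Literature.AlgebraicTopology.SingularHomology

namespace Literature.AlgebraicGeometry.HodgeTheory

section HodgeTheory

open Literature.AlgebraicGeometry.Motives

variable {n d : ℕ} {X X' E E' : Motives.SchemeOver ℂ}

/-! ### `f_*` depends only on `f(ℂ)` -/

/-- The Gysin morphism of `f` depends on `f` only through the continuous map `f(ℂ)` on complex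
points (it is `D_X⁻¹ ∘ f(ℂ)_* ∘ D_Y` in the relevant degrees). [cite: FultonYoungTableaux1997, Appendix B §B.1 (5)] -/
theorem complexGysin_congr_mapContinuous (μ : OrientationFamily) {m : ℕ} {Y : Motives.SchemeOver ℂ}
    (hY : IsSmoothProjective m Y) (hX : IsSmoothProjective n X) {f f' : Y ⟶ X}
    (h : AlgPoints.mapContinuous (L := ℂ) f = AlgPoints.mapContinuous (L := ℂ) f') {a b : ℕ}
    (hab : a + 2 * n = b + 2 * m) :
    complexGysin μ hY hX f hab = complexGysin μ hY hX f' hab := by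
  unfold complexGysin
  rw [h]

/-! ### Pull-back along an isomorphism is push-forward along its inverse -/

/-- **`g^* = f_*` for `f ≫ g = 𝟙 X`, `f : X ⟶ X'` birational** (so `f` is an isomorphism with inverse
`g`), smooth projective `n`-folds, complex orientations: by the projection formula
`f_*(f^*(g^* x) ∪ 1_X) = g^* x ∪ f_* 1_X`, where `f^* g^* x = (f ≫ g)^* x = x` and `f_* 1 = 1`
(degree `+1` of a birational morphism for the complex orientations).
[cite: FultonYoungTableaux1997, Appendix B §B.1 (5) and (6)] [cite: Fulton1998, Lemma 19.1.2 and §1.4] -/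
theorem complexBetti_map_eq_complexGysin_of_comp_eq_id (hX : IsSmoothProjective n X)
    (hX' : IsSmoothProjective n X') (f : X ⟶ X') (g : X' ⟶ X) (hfg : f ≫ g = 𝟙 X)
    (hf : Resolution.IsBirational f.left) {a : ℕ} (x : complexBetti X a) :
    complexBetti.map g a x =
      complexGysin complexOrientationFamily hX hX' f (rfl : a + 2 * n = a + 2 * n) x := by
  have hμ : complexOrientationFamily.HasPoincareDuality := hasPoincareDuality_complexOrientationFamily
  have h1 : complexGysin complexOrientationFamily hX hX' f (rfl : 0 + 2 * n = 0 + 2 * n)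
      (singularCohomology.one ℂ (ComplexPoints X)) = singularCohomology.one ℂ (ComplexPoints X') :=
    complexGysin_complexOrientationFamily_one_of_isBirational hX hX' f hf
  have hfg' : complexBetti.map f a (complexBetti.map g a x) = x := by
    rw [← CategoryTheory.comp_apply, ← complexBetti.map_comp, hfg, complexBetti.map_id]
    rfl
  have key := complexGysin_cup hμ hX hX' f (p := a) (q := 0) (a := a) (b := a) (q' := 0)
    (Nat.add_zero a) rfl rfl (Nat.add_zero a) (complexBetti.map g a x)
    (singularCohomology.one ℂ (ComplexPoints X))
  rw [hfg', h1, cupProduct_one' ℂ (Nat.add_zero a), cupProduct_one' ℂ (Nat.add_zero a)] at key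
  exact key.symm

/-- **Gysin images are equivariant under isomorphisms**: for `f : X ⟶ X'`, `g : X' ⟶ X` with
`g ≫ f = 𝟙 X'` and `g` birational (an isomorphism with inverse `f`), and any `φ : E ⟶ X'` from a
smooth projective `d`-fold, `f^*(φ_* y) = (φ ≫ g)_* y` in `Hᵇ(X(ℂ); ℂ)` — the base change of Gysin
morphisms along the fibre square of an isomorphism ("`g^* cl(Z) = cl(g⁻¹ Z)`").
[cite: FultonYoungTableaux1997, Appendix B §B.1 (2), (5) and (6)] [cite: Fulton1998, Lemma 19.1.2 and §1.4] -/
theorem complexBetti_map_complexGysin_of_comp_eq_id (hX : IsSmoothProjective n X)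
    (hX' : IsSmoothProjective n X') (f : X ⟶ X') (g : X' ⟶ X) (hgf : g ≫ f = 𝟙 X')
    (hg : Resolution.IsBirational g.left) (hE : IsSmoothProjective d E) (φ : E ⟶ X') {c b : ℕ}
    (hcb : c + 2 * n = b + 2 * d) (y : complexBetti E c) :
    complexBetti.map f b (complexGysin complexOrientationFamily hE hX' φ hcb y) =
      complexGysin complexOrientationFamily hE hX (φ ≫ g) hcb y := by
  have hμ : complexOrientationFamily.HasPoincareDuality := hasPoincareDuality_complexOrientationFamily
  rw [complexBetti_map_eq_complexGysin_of_comp_eq_id hX' hX g f hgf hg,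
    complexGysin_comp hμ hE hX' hX φ g hcb rfl]
  rfl

/-- **Reparametrising does not change the class**: `(t ≫ φ)_* 1 = φ_* 1` for `t : E' ⟶ E`
birational between smooth projective `d`-folds (e.g. an automorphism of `E`) and `φ : E ⟶ X`
(`(t ≫ φ)_* = φ_* ∘ t_*` and `t_* 1 = 1` for the complex orientations).
[cite: FultonYoungTableaux1997, Appendix B §B.1 (2) and (5)] [cite: Fulton1998, Lemma 19.1.2 and §1.4] -/
theorem complexGysin_comp_one_of_isBirational (hE' : IsSmoothProjective d E')
    (hE : IsSmoothProjective d E) (hX : IsSmoothProjective n X) (t : E' ⟶ E)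
    (ht : Resolution.IsBirational t.left) (φ : E ⟶ X) {b : ℕ} (hb : 0 + 2 * n = b + 2 * d) :
    complexGysin complexOrientationFamily hE' hX (t ≫ φ) hb
        (singularCohomology.one ℂ (ComplexPoints E')) =
      complexGysin complexOrientationFamily hE hX φ hb (singularCohomology.one ℂ (ComplexPoints E)) := by
  have hμ : complexOrientationFamily.HasPoincareDuality := hasPoincareDuality_complexOrientationFamily
  rw [complexGysin_comp hμ hE' hE hX t φ (rfl : 0 + 2 * d = 0 + 2 * d) hb, LinearMap.comp_apply,
    complexGysin_complexOrientationFamily_one_of_isBirational hE' hE t ht]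

/-! ### Birational self-maps act trivially on top cohomology -/

/-- `H₂ₙ(X(ℂ); ℂ) = ℂ · [X(ℂ)]` for `X` smooth projective of dimension `n` (connected closed
oriented `2n`-manifold): Poincaré duality `H⁰ ≅ H₂ₙ`, `a ↦ a ⌢ [X]`, and `H⁰ = ℂ · 1` (a local
copy, for the orientations of a family, of the tree's `exists_eq_smul_fundamentalClass` of
`HyperplaneSectionMonodromyProofs`, kept out of the import cone).
[cite: HatcherAT2002, §3.3 Thm. 3.30 and §3.1 p. 199] -/
private theorem exists_eq_smul_fundamentalClass_aux (μ : OrientationFamily) (hX : IsSmoothProjective n X)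
    (σ : singularHomology ℂ ℂ (ComplexPoints X) (2 * n)) :
    ∃ c : ℂ, σ = c • (μ hX).fundamentalClass := by
  haveI := connectedSpace_complexPoints hX
  letI := hX.chartedSpace
  haveI := ChartedSpace.locallyPathConnectedSpace (H := EuclideanSpace ℝ (Fin (2 * n)))
    (M := ComplexPoints X)
  haveI : PathConnectedSpace (ComplexPoints X) := pathConnectedSpace_iff_connectedSpace.2 inferInstance
  obtain ⟨a, ha⟩ := (OrientationFamily.hasPoincareDuality μ hX (show 0 + 2 * n = 2 * n by omega)).2 σ
  refine ⟨singularCohomologyZeroEquiv ℂ ℂ (ComplexPoints X) a, ?_⟩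
  rw [← ha, poincareDualityMap_apply]
  conv_lhs => rw [singularCohomology.eq_smul_one ℂ a, map_smul, LinearMap.smul_apply, one_capProduct]

/-- **A birational self-map of a smooth projective `n`-fold acts as the identity on
`H²ⁿ(X(ℂ); ℂ)`**: `⟨t^* y, [X]⟩ = ⟨y, t(ℂ)_* [X]⟩ = ⟨y, [X]⟩` for the complex orientation (degree
`+1`, Fulton Lemma 19.1.2 / Milnor–Stasheff §13), `H₂ₙ = ℂ · [X]`, and the Kronecker map is injective
over a field (Hatcher Thm. 3.2). In particular automorphisms act trivially on top cohomology.
[cite: Fulton1998, Lemma 19.1.2 and §1.4] [cite: HatcherAT2002, §3.1 Thm. 3.2 and §3.3 Thm. 3.30] -/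
theorem complexBetti_map_top_eq_self_of_isBirational (hX : IsSmoothProjective n X) (t : X ⟶ X)
    (ht : Resolution.IsBirational t.left) (y : complexBetti X (2 * n)) :
    complexBetti.map t (2 * n) y = y := by
  apply kroneckerPairing_injective_of_field ℂ (ComplexPoints X) (2 * n)
  refine LinearMap.ext fun σ ↦ ?_
  obtain ⟨c, rfl⟩ := exists_eq_smul_fundamentalClass_aux complexOrientationFamily hX σ
  rw [map_smul, map_smul, complexBetti.map, kroneckerPairing_map,
    map_fundamentalClass_complexOrientationFamily_of_isBirational hX hX t ht]

end HodgeTheory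

end Literature.AlgebraicGeometry.HodgeTheory

end
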